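import Summits.MatrixMultiplication.OmegaCensus.STPPPairDifferenceFilter

/-!
# ω-census (abelian STPP census): N13 certificates for the ℤ₅₇ endgame leaves (kit GO #47 'parts-57d' tier L)

HONEST FRAMING (pub-omega census; verbatim): lottery ticket; floor = certified bounds/negative ranges.
Census BOOKKEEPING (seat pub-omega-stpp-1 gen 26): each theorem says that the named block pattern carries no STPP family (CKSU Def. 5.1, the tree's
`IsSTPP`) in ANY abelian group of order 57, by the kernel filter N13 (`CubeNB.not_isSTPP_of_n13Dead'`, `STPPPairDifferenceFilter.lean`); the numeric
side `N13Dead 57` is evaluated by `decide +kernel`.  Source list: HOME `pub-omega-stpp-1-g26/n13/N13-Z57-tierL29.json` (the 26 N13-dead leaves among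
the 29 undecided leaves of the ℤ₅₇ endgame; `(2,2,5)³` and `{(1,1,2),(2,7,4)}` are in `STPPPairDifferenceFilter.lean` itself, and
`{(1,1,5),(1,3,3),(2,2,5),(2,6,2)}` is already the tree's N11 example `no_isSTPP_Z57_115_133_225_262`).  Nothing on `ω`.
-/

open Finset Literature.Computability.AlgebraicComplexity

namespace Summit.MatrixMultiplication.OmegaCensus.CubeNB

variable {H : Type*} [AddCommGroup H] [DecidableEq H] [Fintype H]

/-- No STPP family with blocks `[(1, 1, 8), (2, 5, 5)]` in an abelian group of order `57` (filter N13). [cite: CohnKleinbergSzegedyUmans2005, Def. 5.1] -/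
theorem no_isSTPP_Z57_118_255 (hH : Fintype.card H = 57) (A B C : Fin 2 → Finset H) (hS : IsSTPP A B C)
    (hA : ∀ i, #(A i) = ![1, 2] i) (hB : ∀ i, #(B i) = ![1, 5] i) (hC : ∀ i, #(C i) = ![8, 5] i) : False :=
  not_isSTPP_of_n13Dead' hS hH _ _ _ hA hB hC (by decide) (by decide +kernel)

/-- No STPP family with blocks `[(1, 1, 10), (2, 6, 4)]` in an abelian group of order `57` (filter N13). [cite: CohnKleinbergSzegedyUmans2005, Def. 5.1] -/
theorem no_isSTPP_Z57_11a_264 (hH : Fintype.card H = 57) (A B C : Fin 2 → Finset H) (hS : IsSTPP A B C)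
    (hA : ∀ i, #(A i) = ![1, 2] i) (hB : ∀ i, #(B i) = ![1, 6] i) (hC : ∀ i, #(C i) = ![10, 4] i) : False :=
  not_isSTPP_of_n13Dead' hS hH _ _ _ hA hB hC (by decide) (by decide +kernel)

/-- No STPP family with blocks `[(1, 1, 16), (2, 3, 7)]` in an abelian group of order `57` (filter N13). [cite: CohnKleinbergSzegedyUmans2005, Def. 5.1] -/
theorem no_isSTPP_Z57_11g_237 (hH : Fintype.card H = 57) (A B C : Fin 2 → Finset H) (hS : IsSTPP A B C)
    (hA : ∀ i, #(A i) = ![1, 2] i) (hB : ∀ i, #(B i) = ![1, 3] i) (hC : ∀ i, #(C i) = ![16, 7] i) : False :=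
  not_isSTPP_of_n13Dead' hS hH _ _ _ hA hB hC (by decide) (by decide +kernel)

/-- No STPP family with blocks `[(1, 1, 18), (2, 4, 5)]` in an abelian group of order `57` (filter N13). [cite: CohnKleinbergSzegedyUmans2005, Def. 5.1] -/
theorem no_isSTPP_Z57_11i_245 (hH : Fintype.card H = 57) (A B C : Fin 2 → Finset H) (hS : IsSTPP A B C)
    (hA : ∀ i, #(A i) = ![1, 2] i) (hB : ∀ i, #(B i) = ![1, 4] i) (hC : ∀ i, #(C i) = ![18, 5] i) : False :=
  not_isSTPP_of_n13Dead' hS hH _ _ _ hA hB hC (by decide) (by decide +kernel)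

/-- No STPP family with blocks `[(1, 1, 18), (2, 5, 4)]` in an abelian group of order `57` (filter N13). [cite: CohnKleinbergSzegedyUmans2005, Def. 5.1] -/
theorem no_isSTPP_Z57_11i_254 (hH : Fintype.card H = 57) (A B C : Fin 2 → Finset H) (hS : IsSTPP A B C)
    (hA : ∀ i, #(A i) = ![1, 2] i) (hB : ∀ i, #(B i) = ![1, 5] i) (hC : ∀ i, #(C i) = ![18, 4] i) : False :=
  not_isSTPP_of_n13Dead' hS hH _ _ _ hA hB hC (by decide) (by decide +kernel)

/-- No STPP family with blocks `[(1, 5, 7), (6, 2, 2)]` in an abelian group of order `57` (filter N13). [cite: CohnKleinbergSzegedyUmans2005, Def. 5.1] -/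
theorem no_isSTPP_Z57_157_622 (hH : Fintype.card H = 57) (A B C : Fin 2 → Finset H) (hS : IsSTPP A B C)
    (hA : ∀ i, #(A i) = ![1, 6] i) (hB : ∀ i, #(B i) = ![5, 2] i) (hC : ∀ i, #(C i) = ![7, 2] i) : False :=
  not_isSTPP_of_n13Dead' hS hH _ _ _ hA hB hC (by decide) (by decide +kernel)

/-- No STPP family with blocks `[(1, 6, 6), (6, 2, 2)]` in an abelian group of order `57` (filter N13). [cite: CohnKleinbergSzegedyUmans2005, Def. 5.1] -/
theorem no_isSTPP_Z57_166_622 (hH : Fintype.card H = 57) (A B C : Fin 2 → Finset H) (hS : IsSTPP A B C)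
    (hA : ∀ i, #(A i) = ![1, 6] i) (hB : ∀ i, #(B i) = ![6, 2] i) (hC : ∀ i, #(C i) = ![6, 2] i) : False :=
  not_isSTPP_of_n13Dead' hS hH _ _ _ hA hB hC (by decide) (by decide +kernel)

/-- No STPP family with blocks `[(2, 2, 3), (2, 2, 12)]` in an abelian group of order `57` (filter N13). [cite: CohnKleinbergSzegedyUmans2005, Def. 5.1] -/
theorem no_isSTPP_Z57_223_22c (hH : Fintype.card H = 57) (A B C : Fin 2 → Finset H) (hS : IsSTPP A B C)
    (hA : ∀ i, #(A i) = ![2, 2] i) (hB : ∀ i, #(B i) = ![2, 2] i) (hC : ∀ i, #(C i) = ![3, 12] i) : False :=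
  not_isSTPP_of_n13Dead' hS hH _ _ _ hA hB hC (by decide) (by decide +kernel)

/-- No STPP family with blocks `[(2, 2, 3), (2, 12, 2)]` in an abelian group of order `57` (filter N13). [cite: CohnKleinbergSzegedyUmans2005, Def. 5.1] -/
theorem no_isSTPP_Z57_223_2c2 (hH : Fintype.card H = 57) (A B C : Fin 2 → Finset H) (hS : IsSTPP A B C)
    (hA : ∀ i, #(A i) = ![2, 2] i) (hB : ∀ i, #(B i) = ![2, 12] i) (hC : ∀ i, #(C i) = ![3, 2] i) : False :=
  not_isSTPP_of_n13Dead' hS hH _ _ _ hA hB hC (by decide) (by decide +kernel)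

/-- No STPP family with blocks `[(2, 2, 4), (2, 2, 11)]` in an abelian group of order `57` (filter N13). [cite: CohnKleinbergSzegedyUmans2005, Def. 5.1] -/
theorem no_isSTPP_Z57_224_22b (hH : Fintype.card H = 57) (A B C : Fin 2 → Finset H) (hS : IsSTPP A B C)
    (hA : ∀ i, #(A i) = ![2, 2] i) (hB : ∀ i, #(B i) = ![2, 2] i) (hC : ∀ i, #(C i) = ![4, 11] i) : False :=
  not_isSTPP_of_n13Dead' hS hH _ _ _ hA hB hC (by decide) (by decide +kernel)

/-- No STPP family with blocks `[(2, 2, 5), (2, 2, 10)]` in an abelian group of order `57` (filter N13). [cite: CohnKleinbergSzegedyUmans2005, Def. 5.1] -/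
theorem no_isSTPP_Z57_225_22a (hH : Fintype.card H = 57) (A B C : Fin 2 → Finset H) (hS : IsSTPP A B C)
    (hA : ∀ i, #(A i) = ![2, 2] i) (hB : ∀ i, #(B i) = ![2, 2] i) (hC : ∀ i, #(C i) = ![5, 10] i) : False :=
  not_isSTPP_of_n13Dead' hS hH _ _ _ hA hB hC (by decide) (by decide +kernel)

/-- No STPP family with blocks `[(2, 2, 6), (2, 2, 9)]` in an abelian group of order `57` (filter N13). [cite: CohnKleinbergSzegedyUmans2005, Def. 5.1] -/
theorem no_isSTPP_Z57_226_229 (hH : Fintype.card H = 57) (A B C : Fin 2 → Finset H) (hS : IsSTPP A B C)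
    (hA : ∀ i, #(A i) = ![2, 2] i) (hB : ∀ i, #(B i) = ![2, 2] i) (hC : ∀ i, #(C i) = ![6, 9] i) : False :=
  not_isSTPP_of_n13Dead' hS hH _ _ _ hA hB hC (by decide) (by decide +kernel)

/-- No STPP family with blocks `[(2, 2, 7), (2, 2, 8)]` in an abelian group of order `57` (filter N13). [cite: CohnKleinbergSzegedyUmans2005, Def. 5.1] -/
theorem no_isSTPP_Z57_227_228 (hH : Fintype.card H = 57) (A B C : Fin 2 → Finset H) (hS : IsSTPP A B C)
    (hA : ∀ i, #(A i) = ![2, 2] i) (hB : ∀ i, #(B i) = ![2, 2] i) (hC : ∀ i, #(C i) = ![7, 8] i) : False :=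
  not_isSTPP_of_n13Dead' hS hH _ _ _ hA hB hC (by decide) (by decide +kernel)

/-- No STPP family with blocks `[(1, 1, 4), (1, 12, 2), (3, 2, 5)]` in an abelian group of order `57` (filter N13). [cite: CohnKleinbergSzegedyUmans2005, Def. 5.1] -/
theorem no_isSTPP_Z57_114_1c2_325 (hH : Fintype.card H = 57) (A B C : Fin 3 → Finset H) (hS : IsSTPP A B C)
    (hA : ∀ i, #(A i) = ![1, 1, 3] i) (hB : ∀ i, #(B i) = ![1, 12, 2] i) (hC : ∀ i, #(C i) = ![4, 2, 5] i) : False :=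
  not_isSTPP_of_n13Dead' hS hH _ _ _ hA hB hC (by decide) (by decide +kernel)

/-- No STPP family with blocks `[(1, 1, 9), (1, 1, 9), (2, 4, 5)]` in an abelian group of order `57` (filter N13). [cite: CohnKleinbergSzegedyUmans2005, Def. 5.1] -/
theorem no_isSTPP_Z57_119_119_245 (hH : Fintype.card H = 57) (A B C : Fin 3 → Finset H) (hS : IsSTPP A B C)
    (hA : ∀ i, #(A i) = ![1, 1, 2] i) (hB : ∀ i, #(B i) = ![1, 1, 4] i) (hC : ∀ i, #(C i) = ![9, 9, 5] i) : False :=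
  not_isSTPP_of_n13Dead' hS hH _ _ _ hA hB hC (by decide) (by decide +kernel)

/-- No STPP family with blocks `[(1, 2, 2), (3, 2, 4), (5, 6, 1)]` in an abelian group of order `57` (filter N13). [cite: CohnKleinbergSzegedyUmans2005, Def. 5.1] -/
theorem no_isSTPP_Z57_122_324_561 (hH : Fintype.card H = 57) (A B C : Fin 3 → Finset H) (hS : IsSTPP A B C)
    (hA : ∀ i, #(A i) = ![1, 3, 5] i) (hB : ∀ i, #(B i) = ![2, 2, 6] i) (hC : ∀ i, #(C i) = ![2, 4, 1] i) : False :=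
  not_isSTPP_of_n13Dead' hS hH _ _ _ hA hB hC (by decide) (by decide +kernel)

/-- No STPP family with blocks `[(2, 2, 3), (2, 2, 3), (2, 2, 9)]` in an abelian group of order `57` (filter N13). [cite: CohnKleinbergSzegedyUmans2005, Def. 5.1] -/
theorem no_isSTPP_Z57_223_223_229 (hH : Fintype.card H = 57) (A B C : Fin 3 → Finset H) (hS : IsSTPP A B C)
    (hA : ∀ i, #(A i) = ![2, 2, 2] i) (hB : ∀ i, #(B i) = ![2, 2, 2] i) (hC : ∀ i, #(C i) = ![3, 3, 9] i) : False :=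
  not_isSTPP_of_n13Dead' hS hH _ _ _ hA hB hC (by decide) (by decide +kernel)

/-- No STPP family with blocks `[(2, 2, 3), (2, 2, 4), (2, 2, 8)]` in an abelian group of order `57` (filter N13). [cite: CohnKleinbergSzegedyUmans2005, Def. 5.1] -/
theorem no_isSTPP_Z57_223_224_228 (hH : Fintype.card H = 57) (A B C : Fin 3 → Finset H) (hS : IsSTPP A B C)
    (hA : ∀ i, #(A i) = ![2, 2, 2] i) (hB : ∀ i, #(B i) = ![2, 2, 2] i) (hC : ∀ i, #(C i) = ![3, 4, 8] i) : False :=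
  not_isSTPP_of_n13Dead' hS hH _ _ _ hA hB hC (by decide) (by decide +kernel)

/-- No STPP family with blocks `[(2, 2, 3), (2, 2, 5), (2, 2, 7)]` in an abelian group of order `57` (filter N13). [cite: CohnKleinbergSzegedyUmans2005, Def. 5.1] -/
theorem no_isSTPP_Z57_223_225_227 (hH : Fintype.card H = 57) (A B C : Fin 3 → Finset H) (hS : IsSTPP A B C)
    (hA : ∀ i, #(A i) = ![2, 2, 2] i) (hB : ∀ i, #(B i) = ![2, 2, 2] i) (hC : ∀ i, #(C i) = ![3, 5, 7] i) : False :=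
  not_isSTPP_of_n13Dead' hS hH _ _ _ hA hB hC (by decide) (by decide +kernel)

/-- No STPP family with blocks `[(2, 2, 3), (2, 2, 6), (2, 2, 6)]` in an abelian group of order `57` (filter N13). [cite: CohnKleinbergSzegedyUmans2005, Def. 5.1] -/
theorem no_isSTPP_Z57_223_226_226 (hH : Fintype.card H = 57) (A B C : Fin 3 → Finset H) (hS : IsSTPP A B C)
    (hA : ∀ i, #(A i) = ![2, 2, 2] i) (hB : ∀ i, #(B i) = ![2, 2, 2] i) (hC : ∀ i, #(C i) = ![3, 6, 6] i) : False :=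
  not_isSTPP_of_n13Dead' hS hH _ _ _ hA hB hC (by decide) (by decide +kernel)

/-- No STPP family with blocks `[(2, 2, 4), (2, 2, 4), (2, 2, 7)]` in an abelian group of order `57` (filter N13). [cite: CohnKleinbergSzegedyUmans2005, Def. 5.1] -/
theorem no_isSTPP_Z57_224_224_227 (hH : Fintype.card H = 57) (A B C : Fin 3 → Finset H) (hS : IsSTPP A B C)
    (hA : ∀ i, #(A i) = ![2, 2, 2] i) (hB : ∀ i, #(B i) = ![2, 2, 2] i) (hC : ∀ i, #(C i) = ![4, 4, 7] i) : False :=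
  not_isSTPP_of_n13Dead' hS hH _ _ _ hA hB hC (by decide) (by decide +kernel)

/-- No STPP family with blocks `[(2, 2, 4), (2, 2, 5), (2, 2, 6)]` in an abelian group of order `57` (filter N13). [cite: CohnKleinbergSzegedyUmans2005, Def. 5.1] -/
theorem no_isSTPP_Z57_224_225_226 (hH : Fintype.card H = 57) (A B C : Fin 3 → Finset H) (hS : IsSTPP A B C)
    (hA : ∀ i, #(A i) = ![2, 2, 2] i) (hB : ∀ i, #(B i) = ![2, 2, 2] i) (hC : ∀ i, #(C i) = ![4, 5, 6] i) : False :=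
  not_isSTPP_of_n13Dead' hS hH _ _ _ hA hB hC (by decide) (by decide +kernel)


/-- No STPP family with blocks `[(1, 3, 3), (1, 3, 3), (2, 2, 5), (2, 5, 2)]` in an abelian group of order `57` (filter N13). [cite: CohnKleinbergSzegedyUmans2005, Def. 5.1] -/
theorem no_isSTPP_Z57_133_133_225_252 (hH : Fintype.card H = 57) (A B C : Fin 4 → Finset H) (hS : IsSTPP A B C)
    (hA : ∀ i, #(A i) = ![1, 1, 2, 2] i) (hB : ∀ i, #(B i) = ![3, 3, 2, 5] i) (hC : ∀ i, #(C i) = ![3, 3, 5, 2] i) : False :=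
  not_isSTPP_of_n13Dead' hS hH _ _ _ hA hB hC (by decide) (by decide +kernel)

end Summit.MatrixMultiplication.OmegaCensus.CubeNB
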